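import Mathlib
import HarnessLib
import Summits.Ventures.LatticeQCDFlow.Exactness.DoeblinObservables
import Summits.Ventures.LatticeQCDFlow.Exactness.DoeblinUniqueness
import Summits.Ventures.LatticeQCDFlow.Exactness.DoeblinTauInt
import Summits.Ventures.LatticeQCDFlow.Scoring.DoeblinSkeleton
import Summits.Ventures.LatticeQCDFlow.Scoring.ChainBurnIn
import Summits.Ventures.LatticeQCDFlow.Exactness.NCMCGeneralSpaceMarkovErgodicCriteria

/-!
# A Doeblin minorisation of a POWER of the kernel: uniqueness, geometric convergence from every start, ergodicity, certified burn-in, event autocorrelations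

HONEST FRAMING: exact (Metropolis-corrected) sampling algorithms for lattice gauge theory;
figures of merit are autocorrelation/cost numbers at stated couplings and volumes; no
continuum-physics claim.

Venture `LatticeQCDFlow` (cell pub-lqcd), topic `Exactness`; FANOUT row 13 (`eng-snf`, GEN-18).
NEW WORK of the cell (textbook Markov-chain facts), not a published result; no definition is
introduced; nothing is cited as a fact — the one published input is the tree's FORMALISED Doeblin
theorem `Literature.Probability.MarkovChains.Doeblin.doeblin_iterate_sub_invariant_le`
(Meyn–Tweedie 1993 Thm 16.2.4), applied to the skeleton kernel `nHit κ m`.  Printed counterpart,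
NAMED ONLY: the `m`-skeleton form of Doeblin's condition, rate `(1 − ε)^{⌊t/m⌋}` (Meyn–Tweedie 1993
Thm 16.0.2; Rosenthal 1995).  WHY: the iteration kernel of `latflow-snf`'s NCMC lane has no one-step
Doeblin minorisation in general but its SQUARE has one (`NCMCGeneralSpaceOccupancyChainDoeblin`);
row 9's Doeblin files and GEN-16's criteria are one-step, row 8's `Scoring/DoeblinSkeleton` is
`m`-step but minorised BY `π` itself.  Here: `m`-step, ARBITRARY minorising probability law `ν`.

## Content (`κ` Markov on `S`, invariant probability law `π`; `(nHit κ m)(x, ·) ≥ ε ν` for all `x`)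

* §1 algebra of row 9's iterate `nHit`: `nHit_add`, `nHit_mul`, `nHit_one`, `nHit_two`,
  `bind_nHit_eq_iterate`, `nHit_apply_mul_add` (`κ^{mq+r}(x,·) = (· ∘ κ^m)^[q] κ^r(x,·)`);
  `minorised_setwise`, `eps_le_one_of_minorised`.
* §2 **`doeblin_nHit_sub_le_of_nHit`** — `|κᵗ(x, A) − π(A)| ≤ (1 − ε)^{⌊t/m⌋}` for EVERY start `x`,
  every `t`, every `A`; `doeblin_bind_nHit_sub_le_of_nHit` (any initial law);
  `doeblin_integral_nHit_sub_le_of_nHit` (`[0,1]`-valued observables);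
  **`invariant_unique_of_nHit_minorised`**; **`ergodic_shift_chain_of_nHit_minorised`** (an almost
  invariant set of `κ` is one of `κ^m` — GEN-16's `ae_pow_apply_eq_zero`).
* §3 **`chain_bias_le_of_nHit`**, **`chain_timeAverage_bias_le_of_nHit`** — CERTIFIED BURN-IN from
  ANY initial law for `[0,1]`-valued `g`: `|E_{μ₀} g(X_t) − πg| ≤ (1 − ε)^{⌊t/m⌋}`,
  `|E_{μ₀}[(1/n) Σ_{t<n} g(X_t)] − πg| ≤ m/(ε n)`.
* §4 events in equilibrium: **`abs_setAutocov_le_of_nHit`** (`|C_t(A,B)| ≤ π(A)(1 − ε)^{⌊t/m⌋}`),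
  `tsum_abs_setAutocov_le_of_nHit` (`≤ m π(A)/ε`), `abs_setACF_le_of_nHit`,
  **`tauInt_setACF_le_of_nHit`** (`τ_int(1_A) ≤ 1/2 + (m/ε − 1)/(1 − π(A))`, scorers' `tauInt`).

NOT CLAIMED: unbounded observables; reversibility / spectral improvements; any constant of ours.
Every-start statements: `NCMCGeneralSpaceDoeblinPowerEveryStart.lean`.
-/

namespace Summit.Ventures.LatticeQCDFlow.Exactness.GeneralNCMC

open MeasureTheory ProbabilityTheory Set Filter Finset
open scoped ENNReal Topology

variable {S : Type*} [MeasurableSpace S]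

/-! ## §1 Algebra of the iterate `nHit` -/

section Algebra

variable (κ : Kernel S S)

/-- `κ^{a+b} = κ^a ∘ₖ κ^b`. -/
theorem nHit_add (a b : ℕ) : nHit κ (a + b) = nHit κ a ∘ₖ nHit κ b := by
  induction a with
  | zero => rw [Nat.zero_add, nHit_zero, Kernel.id_comp]
  | succ a ih => rw [Nat.succ_add, nHit_succ, nHit_succ, ih, Kernel.comp_assoc]

/-- `κ^{m q} = (κ^m)^q`. -/
theorem nHit_mul (m q : ℕ) : nHit κ (m * q) = nHit (nHit κ m) q := by
  induction q with
  | zero => rw [Nat.mul_zero, nHit_zero, nHit_zero]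
  | succ q ih => rw [Nat.mul_succ, Nat.add_comm, nHit_add, ih, nHit_succ]

/-- `κ^1 = κ`. -/
theorem nHit_one : nHit κ 1 = κ := by
  rw [nHit_succ, nHit_zero, Kernel.comp_id]

/-- `κ^2 = κ ∘ₖ κ`. -/
theorem nHit_two : nHit κ 2 = κ ∘ₖ κ := by
  rw [show (2 : ℕ) = 1 + 1 from rfl, nHit_succ, nHit_one]

/-- `μ ∘ κⁿ` is the `n`-th `bind`-iterate of `μ`. -/
theorem bind_nHit_eq_iterate (μ : Measure S) :
    ∀ q : ℕ, μ.bind (nHit κ q) = (fun ρ : Measure S => ρ.bind κ)^[q] μ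
  | 0 => by
      rw [nHit_zero, Function.iterate_zero, id]
      exact (invariant_id (μ := μ)).def
  | q + 1 => by
      rw [nHit_succ, Function.iterate_succ_apply', ← bind_nHit_eq_iterate μ q]
      exact (Measure.comp_assoc (μ := μ) (κ := nHit κ q) (η := κ)).symm

/-- `κ^{mq+r}(x, ·)` is the `q`-th `bind`-iterate by the skeleton `κ^m` of the law `κ^r(x, ·)`. -/
theorem nHit_apply_mul_add (m q r : ℕ) (x : S) :
    nHit κ (m * q + r) x = (fun ρ : Measure S => ρ.bind (nHit κ m))^[q] (nHit κ r x) := by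
  rw [nHit_add, nHit_mul, Kernel.comp_apply, bind_nHit_eq_iterate]

variable {κ}

/-- Measure form ⇒ set form of a minorisation. -/
theorem minorised_setwise {K : Kernel S S} {ν : Measure S} {ε : ℝ≥0∞} (h : ∀ a, ε • ν ≤ K a)
    (x : S) {B : Set S} (hB : MeasurableSet B) : ε * ν B ≤ K x B := by
  have hx := Measure.le_iff.1 (h x) B hB
  rwa [Measure.smul_apply, smul_eq_mul] at hx

/-- A minorisation constant of a Markov kernel by a probability law is at most one. -/
theorem eps_le_one_of_minorised {K : Kernel S S} [IsMarkovKernel K] {ν : Measure S}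
    [IsProbabilityMeasure ν] {ε : ℝ≥0∞} (h : ∀ a, ε • ν ≤ K a) [Nonempty S] : ε ≤ 1 := by
  obtain ⟨a⟩ := (inferInstance : Nonempty S)
  have h1 := minorised_setwise h a MeasurableSet.univ
  rwa [measure_univ, measure_univ, mul_one] at h1

end Algebra

/-! ## §2 Setwise geometric convergence from every start; uniqueness; ergodicity -/

section Power

variable {κ : Kernel S S} [IsMarkovKernel κ] {ν : Measure S} [IsProbabilityMeasure ν] {ε : ℝ≥0∞}
  {π : Measure S} [IsProbabilityMeasure π] {m : ℕ}

/-- **`m`-step Doeblin at a Dirac start**: if `(nHit κ m)(x, B) ≥ ε ν(B)` for all `x` and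
measurable `B` (`ε ≤ 1`) and `π` is an invariant probability law of `κ`, then
`|κᵗ(x, A) − π(A)| ≤ (1 − ε)^{⌊t/m⌋}` for EVERY `x`, `t` and `A`. -/
theorem doeblin_nHit_sub_le_of_nHit
    (hmin : ∀ x {B : Set S}, MeasurableSet B → ε * ν B ≤ nHit κ m x B) (hε1 : ε ≤ 1)
    (hπ : Kernel.Invariant κ π) (x : S) (t : ℕ) (A : Set S) :
    |(nHit κ t x).real A - π.real A| ≤ (1 - ε.toReal) ^ (t / m) := by
  haveI := isMarkovKernel_nHit κ m
  haveI := isMarkovKernel_nHit κ (t % m)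
  have hK : Kernel.Invariant (nHit κ m) π := invariant_nHit hπ m
  have hx : nHit κ t x =
      (fun ρ : Measure S => ρ.bind (nHit κ m))^[t / m] (nHit κ (t % m) x) := by
    conv_lhs => rw [← Nat.div_add_mod t m]
    exact nHit_apply_mul_add κ m (t / m) (t % m) x
  rw [hx]
  exact Literature.Probability.MarkovChains.Doeblin.doeblin_iterate_sub_invariant_le
    (κ := nHit κ m) hmin hε1 hK (nHit κ (t % m) x) (t / m) A

/-- **… from any initial law**: `|(μ₀ ∘ κᵗ)(A) − π(A)| ≤ (1 − ε)^{⌊t/m⌋}`. -/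
theorem doeblin_bind_nHit_sub_le_of_nHit
    (hmin : ∀ x {B : Set S}, MeasurableSet B → ε * ν B ≤ nHit κ m x B) (hε1 : ε ≤ 1)
    (hπ : Kernel.Invariant κ π) (μ₀ : Measure S) [IsProbabilityMeasure μ₀] (t : ℕ) {A : Set S}
    (hA : MeasurableSet A) :
    |(μ₀.bind (nHit κ t)).real A - π.real A| ≤ (1 - ε.toReal) ^ (t / m) := by
  haveI := isMarkovKernel_nHit κ t
  have hmeas : Measurable fun x => nHit κ t x A := Kernel.measurable_coe _ hA
  have hint : Integrable (fun x => (nHit κ t x).real A) μ₀ :=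
    (integrable_const (1 : ℝ)).mono' hmeas.ennreal_toReal.aestronglyMeasurable
      (ae_of_all _ fun x => by
        rw [Real.norm_eq_abs, abs_of_nonneg measureReal_nonneg]
        exact measureReal_le_one)
  have hreal : (μ₀.bind (nHit κ t)).real A = ∫ x, (nHit κ t x).real A ∂μ₀ := by
    rw [measureReal_def, Measure.bind_apply hA (Kernel.aemeasurable _),
      ← integral_toReal hmeas.aemeasurable (ae_of_all _ fun x => measure_lt_top _ _)]
    rfl
  rw [hreal, show ∫ x, (nHit κ t x).real A ∂μ₀ - π.real A =
      ∫ x, ((nHit κ t x).real A - π.real A) ∂μ₀ by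
        rw [integral_sub hint (integrable_const _), integral_const, probReal_univ, one_smul]]
  calc |∫ x, ((nHit κ t x).real A - π.real A) ∂μ₀|
      = ‖∫ x, ((nHit κ t x).real A - π.real A) ∂μ₀‖ := (Real.norm_eq_abs _).symm
    _ ≤ (1 - ε.toReal) ^ (t / m) * μ₀.real univ :=
        norm_integral_le_of_norm_le_const (Eventually.of_forall fun x => by
          rw [Real.norm_eq_abs]
          exact doeblin_nHit_sub_le_of_nHit hmin hε1 hπ x t A)
    _ = (1 - ε.toReal) ^ (t / m) := by rw [probReal_univ, mul_one]

/-- **`m`-step Doeblin for observables**: `|∫ g dκᵗ(x, ·) − ∫ g dπ| ≤ (1 − ε)^{⌊t/m⌋}` for every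
start `x`, every `t` and every measurable `g` with values in `[0, 1]`. -/
theorem doeblin_integral_nHit_sub_le_of_nHit
    (hmin : ∀ x {B : Set S}, MeasurableSet B → ε * ν B ≤ nHit κ m x B) (hε1 : ε ≤ 1)
    (hπ : Kernel.Invariant κ π) (x : S) (t : ℕ) {g : S → ℝ} (hg : Measurable g)
    (h0 : ∀ y, 0 ≤ g y) (h1 : ∀ y, g y ≤ 1) :
    |∫ y, g y ∂(nHit κ t x) - ∫ y, g y ∂π| ≤ (1 - ε.toReal) ^ (t / m) := by
  haveI := isMarkovKernel_nHit κ t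
  exact abs_integral_sub_integral_le_of_setwise
    (fun A _ => doeblin_nHit_sub_le_of_nHit hmin hε1 hπ x t A) hg h0 h1

/-- **A kernel with a Doeblin power has exactly one invariant probability law.** -/
theorem invariant_unique_of_nHit_minorised (h : ∀ a, ε • ν ≤ nHit κ m a) (hε : 0 < ε)
    {π' : Measure S} [IsProbabilityMeasure π'] (hπ : Kernel.Invariant κ π)
    (hπ' : Kernel.Invariant κ π') : π' = π := by
  haveI := isMarkovKernel_nHit κ m
  exact invariant_unique_of_minorised h hε (invariant_nHit hπ m) (invariant_nHit hπ' m)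

/-- **A stationary Markov chain whose kernel has a Doeblin power is ergodic** (an almost invariant
set of `κ` is almost invariant for `κ^m`, which is minorised). -/
theorem ergodic_shift_chain_of_nHit_minorised (hπ : Kernel.Invariant κ π) (hε : ε ≠ 0)
    (hmin : ∀ z t, MeasurableSet t → ε * ν t ≤ nHit κ m z t) :
    Ergodic (fun (x : ℕ → S) (k : ℕ) => x (k + 1))
      (Kernel.trajMeasure (X := fun _ : ℕ => S) π
        (fun n : ℕ => κ.comap (fun h : (j : ↥(Finset.Iic n)) → S => h ⟨n, Finset.mem_Iic.2 le_rfl⟩)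
          (measurable_pi_apply _))) := by
  refine ergodic_shift_chain κ hπ fun B hB hout hin => ?_
  have hin' : ∀ᵐ z ∂π, z ∉ B → (κ ^ m) z B = 0 := ae_pow_apply_eq_zero κ hπ hB hin m
  have hout0 : ∀ᵐ z ∂π, z ∉ Bᶜ → κ z Bᶜ = 0 := by
    filter_upwards [hout] with z hz hzB using hz (Set.notMem_compl_iff.1 hzB)
  have hout' : ∀ᵐ z ∂π, z ∈ B → (κ ^ m) z Bᶜ = 0 := by
    filter_upwards [ae_pow_apply_eq_zero κ hπ hB.compl hout0 m] with z hz hzB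
    exact hz (Set.notMem_compl_iff.2 hzB)
  rw [← Scoring.nHit_eq_pow] at hin' hout'
  exact ae_invariant_trivial_of_minorized (nHit κ m) hε hmin B hB hout' hin'

end Power

/-! ## §3 Certified burn-in from any initial law -/

section BurnIn

variable {κ : Kernel S S} [IsMarkovKernel κ] {ν : Measure S} [IsProbabilityMeasure ν] {ε : ℝ≥0∞}
  {π : Measure S} [IsProbabilityMeasure π] {m : ℕ}

/-- The `t`-step transition operator on a bounded measurable observable is integration against
`κᵗ(x, ·)`: `(kop κ)^[t] g x = ∫ g dκᵗ(x, ·)`. -/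
theorem iterate_kop_eq_integral_nHit {g : S → ℝ} (hg : Measurable g) {C : ℝ} (hC : ∀ x, |g x| ≤ C)
    (t : ℕ) (x : S) : (Scoring.kop κ)^[t] g x = ∫ y, g y ∂(nHit κ t x) := by
  rw [← Scoring.kop_nHit κ t hg hC]
  rfl

/-- **Certified burn-in, per step, `[0,1]`-valued observable, ANY initial law `μ₀`**:
`|E_{μ₀}[g(X_t)] − ∫ g dπ| ≤ (1 − ε)^{⌊t/m⌋}`. -/
theorem chain_bias_le_of_nHit
    (hmin : ∀ x {B : Set S}, MeasurableSet B → ε * ν B ≤ nHit κ m x B) (hε1 : ε ≤ 1)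
    (hπ : Kernel.Invariant κ π) (μ₀ : Measure S) [IsProbabilityMeasure μ₀] {g : S → ℝ}
    (hg : Measurable g) (h0 : ∀ y, 0 ≤ g y) (h1 : ∀ y, g y ≤ 1) (t : ℕ) :
    |∫ x, g (x t) ∂(Kernel.trajMeasure (X := fun _ : ℕ => S) μ₀
        (fun n : ℕ => κ.comap (fun h : (i : ↥(Finset.Iic n)) → S => h ⟨n, Finset.mem_Iic.2 le_rfl⟩)
          (measurable_pi_apply _))) - ∫ x, g x ∂π| ≤ (1 - ε.toReal) ^ (t / m) := by
  have hC : ∀ y, |g y| ≤ 1 := fun y => by rw [abs_of_nonneg (h0 y)]; exact h1 y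
  obtain ⟨hKm, hKb⟩ := Scoring.iterate_kop_bounded_measurable κ hg hC t
  rw [Scoring.chain_expect κ μ₀ hg hC t,
    show ∫ x, (Scoring.kop κ)^[t] g x ∂μ₀ - ∫ x, g x ∂π =
      ∫ x, ((Scoring.kop κ)^[t] g x - ∫ x, g x ∂π) ∂μ₀ by
        rw [integral_sub (Scoring.integrable_of_bounded μ₀ hKm hKb) (integrable_const _),
          integral_const, probReal_univ, one_smul]]
  calc |∫ x, ((Scoring.kop κ)^[t] g x - ∫ x, g x ∂π) ∂μ₀|
      = ‖∫ x, ((Scoring.kop κ)^[t] g x - ∫ x, g x ∂π) ∂μ₀‖ := (Real.norm_eq_abs _).symm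
    _ ≤ (1 - ε.toReal) ^ (t / m) * μ₀.real univ :=
        norm_integral_le_of_norm_le_const (Eventually.of_forall fun x => by
          rw [Real.norm_eq_abs, iterate_kop_eq_integral_nHit hg hC t x]
          exact doeblin_integral_nHit_sub_le_of_nHit hmin hε1 hπ x t hg h0 h1)
    _ = (1 - ε.toReal) ^ (t / m) := by rw [probReal_univ, mul_one]

/-- **Certified burn-in of the time average, ANY initial law**: for `ε > 0`, `m ≥ 1`, every `n ≥ 1`
and every measurable `g` with values in `[0,1]`:
`|E_{μ₀}[(1/n) Σ_{t<n} g(X_t)] − ∫ g dπ| ≤ m/(ε n)`. -/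
theorem chain_timeAverage_bias_le_of_nHit
    (hmin : ∀ x {B : Set S}, MeasurableSet B → ε * ν B ≤ nHit κ m x B) (hε0 : 0 < ε) (hε1 : ε ≤ 1)
    (hm : 0 < m) (hπ : Kernel.Invariant κ π) (μ₀ : Measure S) [IsProbabilityMeasure μ₀]
    {g : S → ℝ} (hg : Measurable g) (h0 : ∀ y, 0 ≤ g y) (h1 : ∀ y, g y ≤ 1) {n : ℕ} (hn : n ≠ 0) :
    |∫ x, (∑ t ∈ range n, g (x t)) / n ∂(Kernel.trajMeasure (X := fun _ : ℕ => S) μ₀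
        (fun n : ℕ => κ.comap (fun h : (i : ↥(Finset.Iic n)) → S => h ⟨n, Finset.mem_Iic.2 le_rfl⟩)
          (measurable_pi_apply _))) - ∫ x, g x ∂π| ≤ m / (ε.toReal * n) := by
  set P := Kernel.trajMeasure (X := fun _ : ℕ => S) μ₀
      (fun n : ℕ => κ.comap (fun h : (i : ↥(Finset.Iic n)) → S => h ⟨n, Finset.mem_Iic.2 le_rfl⟩)
        (measurable_pi_apply _)) with hP
  have hεtop : ε ≠ ∞ := ne_top_of_le_ne_top ENNReal.one_ne_top hε1
  have hεpos : 0 < ε.toReal := ENNReal.toReal_pos hε0.ne' hεtop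
  have hr0 : 0 ≤ 1 - ε.toReal :=
    sub_nonneg.2 (ENNReal.toReal_le_of_le_ofReal zero_le_one (by simpa using hε1))
  have hr1 : 1 - ε.toReal < 1 := sub_lt_self _ hεpos
  have hnpos : (0 : ℝ) < n := by exact_mod_cast Nat.pos_of_ne_zero hn
  have hC : ∀ y, |g y| ≤ 1 := fun y => by rw [abs_of_nonneg (h0 y)]; exact h1 y
  have hint : ∀ t, Integrable (fun x : ℕ → S => g (x t)) P := fun t =>
    Scoring.integrable_of_bounded P (hg.comp (measurable_pi_apply t)) fun x => hC (x t)
  have hstep : ∀ t, |∫ x, g (x t) ∂P - ∫ x, g x ∂π| ≤ (1 - ε.toReal) ^ (t / m) := fun t => by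
    rw [hP]; exact chain_bias_le_of_nHit hmin hε1 hπ μ₀ hg h0 h1 t
  have hmean : ∫ x, (∑ t ∈ range n, g (x t)) / n ∂P = (∑ t ∈ range n, ∫ x, g (x t) ∂P) / n := by
    rw [show (fun x : ℕ → S => (∑ t ∈ range n, g (x t)) / n)
        = fun x => (n : ℝ)⁻¹ * ∑ t ∈ range n, g (x t) by funext x; rw [div_eq_inv_mul],
      integral_const_mul, integral_finsetSum _ (fun t _ => hint t), ← div_eq_inv_mul]
  rw [hmean]
  have hsub : (∑ t ∈ range n, ∫ x, g (x t) ∂P) / n - ∫ x, g x ∂π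
      = (∑ t ∈ range n, (∫ x, g (x t) ∂P - ∫ x, g x ∂π)) / n := by
    rw [Finset.sum_sub_distrib, Finset.sum_const, Finset.card_range, nsmul_eq_mul]
    field_simp
  rw [hsub, abs_div, abs_of_pos hnpos, show (m : ℝ) / (ε.toReal * n) = m / ε.toReal / n by
    rw [div_div]]
  refine div_le_div_of_nonneg_right ?_ hnpos.le
  calc |∑ t ∈ range n, (∫ x, g (x t) ∂P - ∫ x, g x ∂π)|
      ≤ ∑ t ∈ range n, (1 - ε.toReal) ^ (t / m) :=
        (Finset.abs_sum_le_sum_abs _ _).trans (Finset.sum_le_sum fun t _ => hstep t)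
    _ ≤ m / (1 - (1 - ε.toReal)) := Scoring.sum_range_pow_div_le hm hr0 hr1 n
    _ = m / ε.toReal := by rw [sub_sub_cancel]

end BurnIn

/-! ## §4 Events in equilibrium: the autocovariance envelope and `τ_int` -/

section Events

variable {κ : Kernel S S} [IsMarkovKernel κ] {ν : Measure S} [IsProbabilityMeasure ν] {ε : ℝ≥0∞}
  {π : Measure S} [IsProbabilityMeasure π] {m : ℕ}

/-- **Geometric decorrelation of events**: `|C_t(A, B)| ≤ π(A) (1 − ε)^{⌊t/m⌋}`, uniformly in `B`. -/
theorem abs_setAutocov_le_of_nHit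
    (hmin : ∀ x {B : Set S}, MeasurableSet B → ε * ν B ≤ nHit κ m x B) (hε1 : ε ≤ 1)
    (hπ : Kernel.Invariant κ π) (t : ℕ) {A B : Set S} (hA : MeasurableSet A)
    (hB : MeasurableSet B) :
    |setAutocov κ π t A B| ≤ π.real A * (1 - ε.toReal) ^ (t / m) := by
  rw [setAutocov_eq_setIntegral t hA hB, ← Real.norm_eq_abs, mul_comm]
  exact norm_setIntegral_le_of_norm_le_const (measure_lt_top _ _) fun x _ => by
    rw [Real.norm_eq_abs]
    exact doeblin_nHit_sub_le_of_nHit hmin hε1 hπ x t B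

/-- **Summable correlations**: `Σ_t |C_t(A, B)| ≤ m π(A)/ε` (`ε > 0`, `m ≥ 1`). -/
theorem tsum_abs_setAutocov_le_of_nHit
    (hmin : ∀ x {B : Set S}, MeasurableSet B → ε * ν B ≤ nHit κ m x B) (hε0 : 0 < ε) (hε1 : ε ≤ 1)
    (hm : 0 < m) (hπ : Kernel.Invariant κ π) {A B : Set S} (hA : MeasurableSet A)
    (hB : MeasurableSet B) :
    Summable (fun t => |setAutocov κ π t A B|) ∧
      ∑' t, |setAutocov κ π t A B| ≤ m * π.real A / ε.toReal := by
  have hεtop : ε ≠ ∞ := ne_top_of_le_ne_top ENNReal.one_ne_top hε1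
  have hr0 : 0 ≤ 1 - ε.toReal :=
    sub_nonneg.2 (ENNReal.toReal_le_of_le_ofReal zero_le_one (by simpa using hε1))
  have hr1 : 1 - ε.toReal < 1 := sub_lt_self _ (ENNReal.toReal_pos hε0.ne' hεtop)
  have hgeom : Summable fun t : ℕ => π.real A * (1 - ε.toReal) ^ (t / m) :=
    (Scoring.summable_pow_div hm hr0 hr1).mul_left _
  have hle : ∀ t, |setAutocov κ π t A B| ≤ π.real A * (1 - ε.toReal) ^ (t / m) :=
    fun t => abs_setAutocov_le_of_nHit hmin hε1 hπ t hA hB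
  have hsum : Summable fun t => |setAutocov κ π t A B| :=
    Summable.of_nonneg_of_le (fun t => abs_nonneg _) hle hgeom
  refine ⟨hsum, ?_⟩
  calc ∑' t, |setAutocov κ π t A B| ≤ ∑' t : ℕ, π.real A * (1 - ε.toReal) ^ (t / m) :=
        Summable.tsum_le_tsum hle hsum hgeom
    _ = π.real A * ∑' t : ℕ, (1 - ε.toReal) ^ (t / m) := tsum_mul_left
    _ ≤ π.real A * (m / (1 - (1 - ε.toReal))) :=
        mul_le_mul_of_nonneg_left (Scoring.tsum_pow_div_le hm hr0 hr1) measureReal_nonneg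
    _ = m * π.real A / ε.toReal := by rw [sub_sub_cancel]; ring

/-- **Geometric envelope of the event autocorrelation**: `|ρ_A(t)| ≤ (1 − ε)^{⌊t/m⌋}/(1 − π(A))`. -/
theorem abs_setACF_le_of_nHit
    (hmin : ∀ x {B : Set S}, MeasurableSet B → ε * ν B ≤ nHit κ m x B) (hε1 : ε ≤ 1)
    (hπ : Kernel.Invariant κ π) {A : Set S} (hA : MeasurableSet A) (h0 : 0 < π.real A)
    (h1 : π.real A < 1) (t : ℕ) :
    |setACF κ π A t| ≤ (1 - ε.toReal) ^ (t / m) / (1 - π.real A) := by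
  have hpos : 0 < π.real A * (1 - π.real A) := mul_pos h0 (sub_pos.2 h1)
  rw [setACF, setAutocov_zero hA, abs_div, abs_of_pos hpos]
  calc |setAutocov κ π t A A| / (π.real A * (1 - π.real A))
      ≤ π.real A * (1 - ε.toReal) ^ (t / m) / (π.real A * (1 - π.real A)) :=
        div_le_div_of_nonneg_right (abs_setAutocov_le_of_nHit hmin hε1 hπ t hA hA) hpos.le
    _ = (1 - ε.toReal) ^ (t / m) / (1 - π.real A) := mul_div_mul_left _ _ h0.ne'

/-- The tail `t ↦ ρ_A(t+1)` is absolutely summable under an `m`-step Doeblin condition. -/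
theorem summable_setACF_succ_of_nHit
    (hmin : ∀ x {B : Set S}, MeasurableSet B → ε * ν B ≤ nHit κ m x B) (hε0 : 0 < ε) (hε1 : ε ≤ 1)
    (hm : 0 < m) (hπ : Kernel.Invariant κ π) {A : Set S} (hA : MeasurableSet A)
    (h0 : 0 < π.real A) (h1 : π.real A < 1) :
    Summable fun t => setACF κ π A (t + 1) := by
  have hεtop : ε ≠ ∞ := ne_top_of_le_ne_top ENNReal.one_ne_top hε1
  have hr0 : 0 ≤ 1 - ε.toReal :=
    sub_nonneg.2 (ENNReal.toReal_le_of_le_ofReal zero_le_one (by simpa using hε1))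
  have hr1 : 1 - ε.toReal < 1 := sub_lt_self _ (ENNReal.toReal_pos hε0.ne' hεtop)
  have hs : Summable fun t : ℕ => (1 - π.real A)⁻¹ * (1 - ε.toReal) ^ ((t + 1) / m) :=
    ((summable_nat_add_iff 1).2 (Scoring.summable_pow_div hm hr0 hr1)).mul_left _
  refine Summable.of_norm_bounded hs fun t => ?_
  rw [Real.norm_eq_abs]
  calc |setACF κ π A (t + 1)| ≤ (1 - ε.toReal) ^ ((t + 1) / m) / (1 - π.real A) :=
        abs_setACF_le_of_nHit hmin hε1 hπ hA h0 h1 (t + 1)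
    _ = (1 - π.real A)⁻¹ * (1 - ε.toReal) ^ ((t + 1) / m) := by rw [div_eq_inv_mul]

/-- **Every event has a finite integrated autocorrelation time under an `m`-step Doeblin chain**,
in the scorers' convention: `τ_int(1_A) = 1/2 + Σ_{t≥1} ρ_A(t) ≤ 1/2 + (m/ε − 1)/(1 − π(A))`. -/
theorem tauInt_setACF_le_of_nHit
    (hmin : ∀ x {B : Set S}, MeasurableSet B → ε * ν B ≤ nHit κ m x B) (hε0 : 0 < ε) (hε1 : ε ≤ 1)
    (hm : 0 < m) (hπ : Kernel.Invariant κ π) {A : Set S} (hA : MeasurableSet A)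
    (h0 : 0 < π.real A) (h1 : π.real A < 1) :
    Scoring.tauInt (setACF κ π A) ≤ 1 / 2 + (m / ε.toReal - 1) / (1 - π.real A) := by
  have hεtop : ε ≠ ∞ := ne_top_of_le_ne_top ENNReal.one_ne_top hε1
  have hεpos : 0 < ε.toReal := ENNReal.toReal_pos hε0.ne' hεtop
  have hr0 : 0 ≤ 1 - ε.toReal :=
    sub_nonneg.2 (ENNReal.toReal_le_of_le_ofReal zero_le_one (by simpa using hε1))
  have hr1 : 1 - ε.toReal < 1 := sub_lt_self _ hεpos
  have hA1 : 0 < 1 - π.real A := sub_pos.2 h1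
  have hs : Summable fun t : ℕ => (1 - ε.toReal) ^ ((t + 1) / m) :=
    (summable_nat_add_iff 1).2 (Scoring.summable_pow_div hm hr0 hr1)
  have hle : ∀ t, setACF κ π A (t + 1) ≤ (1 - π.real A)⁻¹ * (1 - ε.toReal) ^ ((t + 1) / m) :=
    fun t =>
    calc setACF κ π A (t + 1) ≤ |setACF κ π A (t + 1)| := le_abs_self _
      _ ≤ (1 - ε.toReal) ^ ((t + 1) / m) / (1 - π.real A) :=
          abs_setACF_le_of_nHit hmin hε1 hπ hA h0 h1 (t + 1)
      _ = (1 - π.real A)⁻¹ * (1 - ε.toReal) ^ ((t + 1) / m) := by rw [div_eq_inv_mul]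
  have hsum := Summable.tsum_le_tsum hle (summable_setACF_succ_of_nHit hmin hε0 hε1 hm hπ hA h0 h1)
    (hs.mul_left _)
  rw [tsum_mul_left] at hsum
  have htail : ∑' t : ℕ, (1 - ε.toReal) ^ ((t + 1) / m) ≤ m / ε.toReal - 1 := by
    have h := Scoring.tsum_pow_succ_div_le hm hr0 hr1
    rwa [sub_sub_cancel] at h
  unfold Scoring.tauInt
  calc 1 / 2 + ∑' t, setACF κ π A (t + 1)
      ≤ 1 / 2 + (1 - π.real A)⁻¹ * ∑' t : ℕ, (1 - ε.toReal) ^ ((t + 1) / m) := by linarith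
    _ ≤ 1 / 2 + (1 - π.real A)⁻¹ * (m / ε.toReal - 1) := by
        have := mul_le_mul_of_nonneg_left htail (inv_pos.2 hA1).le
        linarith
    _ = 1 / 2 + (m / ε.toReal - 1) / (1 - π.real A) := by rw [← div_eq_inv_mul]

end Events

end Summit.Ventures.LatticeQCDFlow.Exactness.GeneralNCMC
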